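import Summits.Ventures.PercRepro0.Coupling
import Summits.Ventures.PercRepro0.ContAbove
import Summits.Ventures.PercRepro0.Invariance
import Summits.Ventures.PercRepro0.ZeroOne
import Summits.Ventures.PercRepro0.Events

/-! # R_MID-13 · CRIT-FRAGILE in Lean (p6): the critical configuration is critically fragile

Kernel twin of proofs/CRITFRAGILE-plan-1-v1.md §3 (Theorem CRIT-FRAGILE), lead RULING X:
for `P_{p_c(d)}`-a.e. configuration `G`, every subset `F ⊆ G` and every `q < 1`,
Bernoulli(`q`) bond percolation on `F` (`setBernoulli F q`) has a.s. no infinite cluster.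

Proof choice (the prover's): the paper's Lemma A (the mixture identity) is replaced by the
TWO-LEVEL THRESHOLD COUPLING — two independent i.i.d. uniform families `U, V`, the critical
configuration `G = { e : U_e ≤ p }` and the thinned configuration `{ e ∈ G : V_e ≤ q }`, whose law
is `setBernoulli (bonds d) (p q)`; Fubini on the product of the two families gives the mixture
identity for every measurable event, and the rest is the paper's Steps 1–4.
Inputs: Coupling (p5), ContAbove (p3), Invariance (p5), ZeroOne (p2), Events (p5), on Defs verbatim.
-/

namespace Summit.Ventures.PercRepro0.CritFragile

open MeasureTheory ProbabilityTheory unitInterval Set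
open scoped ENNReal
open Summit.Ventures.PercRepro0.Defs

section TwoLevel

variable {ι : Type*}

/-- The two-level threshold: the bonds of `u` with `U_i ≤ p` and `V_i ≤ q`. -/
theorem mem_threshold_threshold (u : Set ι) (p q : I) (U V : ι → ℝ) (i : ι) :
    i ∈ threshold (threshold u p U) q V ↔ (i ∈ u ∧ U i ≤ p) ∧ V i ≤ q := by
  simp only [threshold, mem_setOf_eq]

/-- Joint measurability of the two-level threshold in the pair `(U, V)`. -/
theorem measurable_threshold_threshold (u : Set ι) (p q : I) :
    Measurable fun x : (ι → ℝ) × (ι → ℝ) => threshold (threshold u p x.1) q x.2 := by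
  rw [measurable_set_iff]
  intro i
  simp only [mem_threshold_threshold]
  rw [← measurableSet_setOf]
  have h1 : MeasurableSet {x : (ι → ℝ) × (ι → ℝ) | i ∈ u ∧ x.1 i ≤ (p : ℝ)} := by
    rw [setOf_and]
    exact (MeasurableSet.const _).inter
      (measurableSet_le ((measurable_pi_apply i).comp measurable_fst) measurable_const)
  have h2 : MeasurableSet {x : (ι → ℝ) × (ι → ℝ) | x.2 i ≤ (q : ℝ)} :=
    measurableSet_le ((measurable_pi_apply i).comp measurable_snd) measurable_const
  rw [setOf_and]
  exact h1.inter h2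

/-- FUBINI (the mixture identity in its coupling form): the uniform-family integral of
`G ↦ setBer(G, q)(A)` over the critical configurations `G = threshold u p U` is the product-measure
mass of `{(U, V) : threshold (threshold u p U) q V ∈ A}`. -/
theorem lintegral_setBernoulli_threshold (u : Set ι) (p q : I) {A : Set (Set ι)}
    (hA : MeasurableSet A) :
    ∫⁻ U, setBernoulli (threshold u p U) q A ∂(Measure.infinitePi fun _ : ι => unif) =
      ((Measure.infinitePi fun _ : ι => unif).prod (Measure.infinitePi fun _ : ι => unif))
        {x : (ι → ℝ) × (ι → ℝ) | threshold (threshold u p x.1) q x.2 ∈ A} := by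
  have hS : MeasurableSet {x : (ι → ℝ) × (ι → ℝ) | threshold (threshold u p x.1) q x.2 ∈ A} :=
    measurable_threshold_threshold u p q hA
  rw [Measure.prod_apply hS]
  refine lintegral_congr fun U => ?_
  rw [← map_threshold_eq_setBernoulli (threshold u p U) q,
    Measure.map_apply (measurable_threshold _ _) hA]
  rfl

/-- `G ↦ setBer(G, q)(A)` is measurable on `Set ι` (Lemma A's measurability clause), from the joint
measurability of `(G, V) ↦ threshold G q V`. -/
theorem measurable_setBernoulli_apply (q : I) {A : Set (Set ι)} (hA : MeasurableSet A) :
    Measurable fun G : Set ι => setBernoulli G q A := by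
  have hm : Measurable fun x : Set ι × (ι → ℝ) => threshold x.1 q x.2 := by
    rw [measurable_set_iff]
    intro i
    show Measurable fun x : Set ι × (ι → ℝ) => (i ∈ x.1 ∧ x.2 i ≤ (q : ℝ))
    rw [← measurableSet_setOf, setOf_and]
    exact (measurable_fst (measurableSet_mem i)).inter
      (measurableSet_le ((measurable_pi_apply i).comp measurable_snd) measurable_const)
  have heq : (fun G : Set ι => setBernoulli G q A) =
      fun G : Set ι => (Measure.infinitePi fun _ : ι => unif) (Prod.mk G ⁻¹' {x : Set ι × (ι → ℝ) | threshold x.1 q x.2 ∈ A}) := by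
    funext G
    rw [← map_threshold_eq_setBernoulli G q, Measure.map_apply (measurable_threshold _ _) hA]
    rfl
  rw [heq]
  exact measurable_measure_prodMk_left (ν := (Measure.infinitePi fun _ : ι => unif)) (hm hA)

/-- LEMMA B (monotone coupling in the bond set and in the parameter): for `F ⊆ F'`, `q ≤ q'` and an
increasing measurable event `A`, `setBer(F, q)(A) ≤ setBer(F', q')(A)`. -/
theorem setBernoulli_mono_of_subset_of_isUpperSet {F F' : Set ι} (hF : F ⊆ F') {q q' : I}
    (hq : q ≤ q') {A : Set (Set ι)} (hA : IsUpperSet A) (hAm : MeasurableSet A) :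
    setBernoulli F q A ≤ setBernoulli F' q' A := by
  rw [← map_threshold_eq_setBernoulli F q, ← map_threshold_eq_setBernoulli F' q',
    Measure.map_apply (measurable_threshold F q) hAm,
    Measure.map_apply (measurable_threshold F' q') hAm]
  refine measure_mono fun U hU => hA ?_ hU
  intro i hi
  exact ⟨hF hi.1, hi.2.trans hq⟩

/-! ### The law of the thinned configuration: `setBer(u, p q)` -/

/-- The uniform mass of the box `{y 0 ≤ p, y 1 ≤ q}` is `p q`. -/
theorem unif2_box (p q : I) :
    (Measure.infinitePi fun _ : Fin 2 => unif) {y : Fin 2 → ℝ | y 0 ≤ (p : ℝ) ∧ y 1 ≤ (q : ℝ)} = ENNReal.ofReal ((p * q : I) : ℝ) := by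
  have hset : {y : Fin 2 → ℝ | y 0 ≤ (p : ℝ) ∧ y 1 ≤ (q : ℝ)} =
      Set.univ.pi fun j : Fin 2 => Iic (![(p : ℝ), (q : ℝ)] j) := by
    ext y
    simp only [Set.mem_setOf_eq, Set.mem_univ_pi, Set.mem_Iic]
    constructor
    · rintro ⟨h0, h1⟩ j
      fin_cases j
      · simpa using h0
      · simpa using h1
    · intro h
      exact ⟨by simpa using h 0, by simpa using h 1⟩
  rw [hset, Measure.infinitePi_eq_pi, Measure.pi_pi, Fin.prod_univ_two]
  simp only [Matrix.cons_val_zero, Matrix.cons_val_one, unif_Iic]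
  rw [Set.Icc.coe_mul, ENNReal.ofReal_mul p.2.1]

/-- The box `{y 0 ≤ p, y 1 ≤ q}` is measurable. -/
theorem measurableSet_box (p q : I) :
    MeasurableSet {y : Fin 2 → ℝ | y 0 ≤ (p : ℝ) ∧ y 1 ≤ (q : ℝ)} := by
  rw [setOf_and]
  exact (measurableSet_le (measurable_pi_apply 0) measurable_const).inter
    (measurableSet_le (measurable_pi_apply 1) measurable_const)

/-- One coordinate of the two-level threshold, as a map `(Fin 2 → ℝ) → Prop`, is measurable. -/
theorem measurable_coord2 (u : Set ι) (p q : I) (i : ι) :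
    Measurable fun y : Fin 2 → ℝ => (i ∈ u ∧ y 0 ≤ (p : ℝ) ∧ y 1 ≤ (q : ℝ)) := by
  rw [← measurableSet_setOf, setOf_and]
  exact (MeasurableSet.const _).inter (measurableSet_box p q)

/-- The law of one coordinate of the two-level threshold is the Bernoulli(`p q`) law used by
`setBernoulli` (the two-dimensional analogue of `unif_map_threshold_coord`). -/
theorem unif2_map_coord (u : Set ι) (p q : I) (i : ι) :
    (Measure.infinitePi fun _ : Fin 2 => unif).map (fun y : Fin 2 → ℝ => (i ∈ u ∧ y 0 ≤ (p : ℝ) ∧ y 1 ≤ (q : ℝ))) =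
      toNNReal (p * q) • Measure.dirac (i ∈ u) + toNNReal (σ (p * q)) • Measure.dirac False := by
  refine Measure.ext_of_singleton fun r => ?_
  rw [Measure.map_apply (measurable_coord2 u p q i) (measurableSet_singleton r),
    Measure.add_apply, Measure.smul_apply, Measure.smul_apply, Measure.dirac_apply,
    Measure.dirac_apply, ENNReal.smul_def, ENNReal.smul_def, smul_eq_mul, smul_eq_mul]
  have hpq0 : (0 : ℝ) ≤ (p * q : I) := (p * q).2.1
  by_cases hr : r
  · rw [eq_true hr]
    by_cases hi : i ∈ u
    · have hpre : (fun y : Fin 2 → ℝ => (i ∈ u ∧ y 0 ≤ (p : ℝ) ∧ y 1 ≤ (q : ℝ))) ⁻¹' {True} =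
          {y : Fin 2 → ℝ | y 0 ≤ (p : ℝ) ∧ y 1 ≤ (q : ℝ)} := by
        ext y
        simp [hi]
      rw [hpre, unif2_box, coe_toNNReal_eq_ofReal]
      simp [hi]
    · have hpre : (fun y : Fin 2 → ℝ => (i ∈ u ∧ y 0 ≤ (p : ℝ) ∧ y 1 ≤ (q : ℝ))) ⁻¹' {True} = ∅ := by
        ext y
        simp [hi]
      rw [hpre, measure_empty]
      simp [hi]
  · rw [eq_false hr]
    by_cases hi : i ∈ u
    · have hpre : (fun y : Fin 2 → ℝ => (i ∈ u ∧ y 0 ≤ (p : ℝ) ∧ y 1 ≤ (q : ℝ))) ⁻¹' {False} =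
          {y : Fin 2 → ℝ | y 0 ≤ (p : ℝ) ∧ y 1 ≤ (q : ℝ)}ᶜ := by
        ext y
        simp [hi]
      rw [hpre, measure_compl (measurableSet_box p q) (measure_ne_top _ _), measure_univ, unif2_box,
        coe_toNNReal_symm_eq_ofReal]
      simp only [hi, Set.indicator_of_notMem
        (show True ∉ ({False} : Set Prop) by simp), mul_zero, zero_add,
        Set.indicator_of_mem (mem_singleton False), Pi.one_apply, mul_one]
      rw [ENNReal.ofReal_sub _ hpq0, ENNReal.ofReal_one]
    · have hpre : (fun y : Fin 2 → ℝ => (i ∈ u ∧ y 0 ≤ (p : ℝ) ∧ y 1 ≤ (q : ℝ))) ⁻¹' {False} =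
          univ := by
        ext y
        simp [hi]
      rw [hpre, measure_univ, coe_toNNReal_eq_ofReal, coe_toNNReal_symm_eq_ofReal]
      have hi' : (i ∈ u) = False := eq_false hi
      rw [hi']
      simp only [Set.indicator_of_mem (mem_singleton False), Pi.one_apply, mul_one]
      rw [← ENNReal.ofReal_add hpq0 (sub_nonneg.2 (p * q).2.2)]
      simp

/-- The law of `Y ↦ { i ∈ u : Y i 0 ≤ p ∧ Y i 1 ≤ q }` under the product of two-dimensional
uniforms is `setBer(u, p q)` (the two-dimensional analogue of `map_threshold_eq_setBernoulli`). -/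
theorem pairs_map_eq_setBernoulli (u : Set ι) (p q : I) :
    (Measure.infinitePi fun _ : ι => Measure.infinitePi fun _ : Fin 2 => unif).map
      (fun Y : ι → Fin 2 → ℝ => {i | i ∈ u ∧ Y i 0 ≤ (p : ℝ) ∧ Y i 1 ≤ (q : ℝ)}) =
      setBernoulli u (p * q) := by
  have hcomp : (fun Y : ι → Fin 2 → ℝ => {i | i ∈ u ∧ Y i 0 ≤ (p : ℝ) ∧ Y i 1 ≤ (q : ℝ)}) =
      (fun P : ι → Prop => {i | P i}) ∘
        fun Y : ι → Fin 2 → ℝ => fun i => (i ∈ u ∧ Y i 0 ≤ (p : ℝ) ∧ Y i 1 ≤ (q : ℝ)) := by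
    funext Y
    rfl
  have hmeas : Measurable fun Y : ι → Fin 2 → ℝ =>
      fun i => (i ∈ u ∧ Y i 0 ≤ (p : ℝ) ∧ Y i 1 ≤ (q : ℝ)) :=
    measurable_pi_lambda _ fun i => (measurable_coord2 u p q i).comp (measurable_pi_apply i)
  rw [hcomp, ← Measure.map_map measurable_setOf hmeas,
    Measure.infinitePi_map_pi _ (fun i => measurable_coord2 u p q i), setBernoulli_eq_map]
  congr 1
  congr 1
  funext i
  exact unif2_map_coord u p q i

/-! ### The product of two uniform families, re-indexed -/

/-- The product of two independent uniform families is the `Fin 2 × ι`-indexed uniform family,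
split into its two rows. -/
theorem prod_unifPi_eq_map_split :
    (Measure.infinitePi fun _ : ι => unif).prod (Measure.infinitePi fun _ : ι => unif) = (Measure.infinitePi fun _ : Fin 2 × ι => unif).map
      (fun W : Fin 2 × ι → ℝ => (fun i => W (0, i), fun i => W (1, i))) := by
  have h1 := Measure.infinitePi_map_curry (fun (_ : Fin 2) (_ : ι) => unif)
  have h2 : (Measure.infinitePi fun _ : Fin 2 => (Measure.infinitePi fun _ : ι => unif)) = Measure.pi fun _ : Fin 2 => (Measure.infinitePi fun _ : ι => unif) :=
    Measure.infinitePi_eq_pi _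
  have h3 := (measurePreserving_finTwoArrow (Measure.infinitePi fun _ : ι => unif)).map_eq
  rw [← h3, ← h2]
  change (Measure.infinitePi fun _ : Fin 2 => Measure.infinitePi fun _ : ι => unif).map _ = _
  rw [← h1, Measure.map_map (MeasurableEquiv.measurable _) (MeasurableEquiv.measurable _)]
  rfl

/-- Re-indexing `ι × Fin 2 → Fin 2 × ι` preserves the uniform family. -/
theorem infinitePi_swap :
    (Measure.infinitePi fun _ : Fin 2 × ι => unif) =
      (Measure.infinitePi fun _ : ι × Fin 2 => unif).map
        (MeasurableEquiv.piCongrLeft (fun _ => ℝ) (Equiv.prodComm ι (Fin 2))) :=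
  (Measure.infinitePi_map_piCongrLeft (fun _ : Fin 2 × ι => unif) (Equiv.prodComm ι (Fin 2))).symm

/-- The `ι × Fin 2`-indexed uniform family is the product over `ι` of two-dimensional uniforms,
uncurried. -/
theorem infinitePi_pairs :
    (Measure.infinitePi fun _ : ι × Fin 2 => unif) =
      (Measure.infinitePi fun _ : ι => Measure.infinitePi fun _ : Fin 2 => unif).map (MeasurableEquiv.curry ι (Fin 2) ℝ).symm := by
  rw [← MeasurableEquiv.map_apply_eq_iff_map_symm_apply_eq]
  exact Measure.infinitePi_map_curry (fun (_ : ι) (_ : Fin 2) => unif)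

/-- The two-level threshold on the split rows, written on the `ι`-indexed family of pairs. -/
theorem threshold_split_comp (u : Set ι) (p q : I) :
    (((fun x : (ι → ℝ) × (ι → ℝ) => threshold (threshold u p x.1) q x.2) ∘
        (fun W : Fin 2 × ι → ℝ => (fun i => W (0, i), fun i => W (1, i)))) ∘
        MeasurableEquiv.piCongrLeft (fun _ => ℝ) (Equiv.prodComm ι (Fin 2))) ∘
        (MeasurableEquiv.curry ι (Fin 2) ℝ).symm =
      fun Y : ι → Fin 2 → ℝ => {i | i ∈ u ∧ Y i 0 ≤ (p : ℝ) ∧ Y i 1 ≤ (q : ℝ)} := by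
  funext Y
  ext i
  simp only [Function.comp_apply, mem_threshold_threshold, mem_setOf_eq]
  have h0 : MeasurableEquiv.piCongrLeft (fun _ => ℝ) (Equiv.prodComm ι (Fin 2))
      ((MeasurableEquiv.curry ι (Fin 2) ℝ).symm Y) (0, i) = Y i 0 :=
    MeasurableEquiv.piCongrLeft_apply_apply (Equiv.prodComm ι (Fin 2)) _ (i, 0)
  have h1 : MeasurableEquiv.piCongrLeft (fun _ => ℝ) (Equiv.prodComm ι (Fin 2))
      ((MeasurableEquiv.curry ι (Fin 2) ℝ).symm Y) (1, i) = Y i 1 :=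
    MeasurableEquiv.piCongrLeft_apply_apply (Equiv.prodComm ι (Fin 2)) _ (i, 1)
  rw [h0, h1, and_assoc]

/-- THE LAW OF THE THINNED CONFIGURATION: under two independent uniform families `U, V`, the
configuration `{ i ∈ u : U_i ≤ p ∧ V_i ≤ q }` has law `setBer(u, p q)` (Lemma A in coupling form). -/
theorem prod_map_threshold_threshold (u : Set ι) (p q : I) :
    ((Measure.infinitePi fun _ : ι => unif).prod (Measure.infinitePi fun _ : ι => unif)).map
      (fun x : (ι → ℝ) × (ι → ℝ) => threshold (threshold u p x.1) q x.2) = setBernoulli u (p * q) := by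
  have hsplit : Measurable (fun W : Fin 2 × ι → ℝ => (fun i => W (0, i), fun i => W (1, i))) :=
    (measurable_pi_lambda _ fun i => measurable_pi_apply (0, i)).prodMk
      (measurable_pi_lambda _ fun i => measurable_pi_apply (1, i))
  rw [prod_unifPi_eq_map_split, Measure.map_map (measurable_threshold_threshold u p q) hsplit,
    infinitePi_swap, Measure.map_map ((measurable_threshold_threshold u p q).comp hsplit)
      (MeasurableEquiv.measurable _),
    infinitePi_pairs, Measure.map_map (((measurable_threshold_threshold u p q).comp hsplit).comp
      (MeasurableEquiv.measurable _)) (MeasurableEquiv.measurable _)]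
  rw [threshold_split_comp]
  exact pairs_map_eq_setBernoulli u p q

end TwoLevel

section Main

variable {d : ℕ}

/-- STEP 1: strictly below `p_c(d)` there is a.s. no infinite cluster anywhere (L0 + translation
invariance F2 + the countable union over the vertices). -/
theorem P_existsInfCluster_eq_zero_of_lt_pc (hd : 1 ≤ d) {r : I} (hr : (r : ℝ) < pc d) :
    P d r (existsInfCluster d) = 0 := by
  have hth : thetaI d r = 0 := by
    have h := ContAbove.theta_eq_zero_of_lt_pc' hd hr
    rwa [theta, clamp, Set.projIcc_val] at h
  have hx : ∀ x : Vertex d, P d r {ω : Config d | ConnInf d ω x} = 0 := by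
    intro x
    have h := P_connInf_eq_thetaI (d := d) r x
    rw [hth, ENNReal.toReal_eq_zero_iff] at h
    exact h.resolve_right (measure_ne_top _ _)
  have hU : existsInfCluster d = ⋃ x : Vertex d, {ω : Config d | ConnInf d ω x} := by
    ext ω
    simp only [existsInfCluster, mem_setOf_eq, mem_iUnion]
  rw [hU]
  exact measure_iUnion_null hx

/-- The critical parameter as an element of the unit interval: `clamp (pc d) = pc d`. -/
theorem coe_clamp_pc (hd : 1 ≤ d) : ((clamp (pc d) : I) : ℝ) = pc d := by
  rw [clamp, Set.projIcc_of_mem zero_le_one (pc_mem_Icc hd)]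

/-- STEP 2 (one thinning parameter `q < 1`): for `P_{p_c(d)}`-a.e. `G`, Bernoulli(`q`) percolation on
`G` has a.s. no infinite cluster — Fubini on the two-level coupling, the law `setBer(bonds, p_c q)`
of the thinned configuration, Step 1 at `p_c(d) q < p_c(d)`, and «a non-negative function with
integral zero vanishes a.e.». -/
theorem ae_setBernoulli_eq_zero (hd : 1 ≤ d) (q : I) (hq : (q : ℝ) < 1) :
    ∀ᵐ G ∂(P d (clamp (pc d))), setBernoulli G q (existsInfCluster d) = 0 := by
  set p : I := clamp (pc d) with hp
  have hpq : (((p * q : I) : I) : ℝ) < pc d := by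
    rw [Set.Icc.coe_mul, hp, coe_clamp_pc hd]
    exact mul_lt_of_lt_one_right (ContAbove.pc_pos hd) hq
  have hzero : P d (p * q) (existsInfCluster d) = 0 := P_existsInfCluster_eq_zero_of_lt_pc hd hpq
  have hE : MeasurableSet (existsInfCluster d) := measurableSet_existsInfCluster
  have hint : ∫⁻ U, setBernoulli (threshold (bonds d) p U) q (existsInfCluster d)
      ∂(Measure.infinitePi fun _ : Sym2 (Vertex d) => unif) = 0 := by
    rw [lintegral_setBernoulli_threshold (bonds d) p q hE]
    change ((Measure.infinitePi fun _ : Sym2 (Vertex d) => unif).prod (Measure.infinitePi fun _ : Sym2 (Vertex d) => unif))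
      ((fun x : (Sym2 (Vertex d) → ℝ) × (Sym2 (Vertex d) → ℝ) =>
        threshold (threshold (bonds d) p x.1) q x.2) ⁻¹' existsInfCluster d) = 0
    rw [← Measure.map_apply (measurable_threshold_threshold (bonds d) p q) hE,
      prod_map_threshold_threshold]
    exact hzero
  have hmeas : Measurable fun U : Sym2 (Vertex d) → ℝ =>
      setBernoulli (threshold (bonds d) p U) q (existsInfCluster d) :=
    (measurable_setBernoulli_apply q hE).comp (measurable_threshold (bonds d) p)
  have hae := (lintegral_eq_zero_iff hmeas).1 hint
  have hset : MeasurableSet {G : Config d | setBernoulli G q (existsInfCluster d) = 0} :=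
    (measurable_setBernoulli_apply q hE) (measurableSet_singleton (0 : ℝ≥0∞))
  show ∀ᵐ G ∂(setBernoulli (bonds d) p), setBernoulli G q (existsInfCluster d) = 0
  rw [← map_threshold_eq_setBernoulli (bonds d) p,
    ae_map_iff (measurable_threshold (bonds d) p).aemeasurable hset]
  exact hae

/-- THEOREM CRIT-FRAGILE (R_MID-13, paper §3): for `P_{p_c(d)}`-a.e. configuration `G`, EVERY
subset `F ⊆ G` and EVERY `q < 1`, Bernoulli(`q`) bond percolation on `F` has a.s. no infinite
cluster — the critical configuration, and every infinite cluster it may have, is critically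
fragile. Steps 3–4 of the paper: the countable union over rational `q`, then Lemma B. -/
theorem critFragile (hd : 1 ≤ d) :
    ∀ᵐ G ∂(P d (clamp (pc d))), ∀ F ⊆ G, ∀ q : I, (q : ℝ) < 1 →
      setBernoulli F q (existsInfCluster d) = 0 := by
  have hall : ∀ᵐ G ∂(P d (clamp (pc d))), ∀ r : {r : ℚ // 0 ≤ r ∧ r < 1},
      setBernoulli G ⟨(r.1 : ℝ), by exact_mod_cast r.2.1, by exact_mod_cast r.2.2.le⟩
        (existsInfCluster d) = 0 := by
    rw [ae_all_iff]
    intro r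
    exact ae_setBernoulli_eq_zero hd _ (show ((r.1 : ℚ) : ℝ) < 1 by exact_mod_cast r.2.2)
  filter_upwards [hall] with G hG
  intro F hF q hq
  obtain ⟨r, hqr, hr1⟩ := exists_rat_btwn hq
  have hr0 : (0 : ℚ) ≤ r := by
    have : (0 : ℝ) ≤ r := q.2.1.trans hqr.le
    exact_mod_cast this
  have hr1' : r < (1 : ℚ) := by exact_mod_cast hr1
  have hle : q ≤ (⟨(r : ℝ), by exact_mod_cast hr0, by exact_mod_cast hr1'.le⟩ : I) := by
    rw [← Subtype.coe_le_coe]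
    exact hqr.le
  refine le_antisymm ?_ (by simp)
  calc setBernoulli F q (existsInfCluster d)
      ≤ setBernoulli G (⟨(r : ℝ), by exact_mod_cast hr0, by exact_mod_cast hr1'.le⟩ : I)
          (existsInfCluster d) :=
        setBernoulli_mono_of_subset_of_isUpperSet hF hle isUpperSet_existsInfCluster
          measurableSet_existsInfCluster
    _ = 0 := hG ⟨r, hr0, hr1'⟩

end Main

end Summit.Ventures.PercRepro0.CritFragile
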